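/-
Copyright: seat `ym-line-cbag-p2` (prover-ym-line-cbag-p2-g0-0), route `ColdBoxAllGroups`, crux `BulkAllGroups`
(stmt-QuantumFields-22255), line `dlr-chessboard-G` (skeleton `Cruxes/BulkAllGroups/Lines/birth.lean`).
-/
import Summits.QuantumFields.YangMills.Theorems.ColdBoxAllGroupsBulkAllGroupsLargeFieldTailG

/-!
# Registered stub L2-G `stub_largeFieldRarityG` of crux `BulkAllGroups` (stmt-QuantumFields-22255), BY NAME —
# part 2 of 2: the volume-uniform large-field rarity of one plaquette, every compact gauge group, every torus side

WHAT.  For a compact group `G` with a faithful continuous unitary lattice representation `r : LatticeRep G` (`d = 4`):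
* `plaquetteLargeFieldRarityG_allSides` — for `0 < δ` there is `β₀` such that for all `β ≥ β₀`, ALL `L ≥ 1`, all sites `x` and
  planes `i ≠ j`, the crude large-field event `{β^{2δ−1} ≤ plaqCostAt r.ρ x i j}` of the plaquette `(x; i, j)` has
  `wilsonExpectation_{(L+1)⁴} ≤ exp(−β^δ)` (observable read through the periodic lift, as in `torusPlaqCov`): part 1's all-sides tail
  `measureReal_plaqCost_ge_le_allSidesG` (`C β^κ e^{−βs/2}`) at `s = β^{2δ−1}` and the elementary asymptotics `poly_exp_tail_le_pow`
  of the `SU(2)` file;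
* `plaquetteLargeFieldRarityG_eventually` — its `∀ᶠ L` form, literally the body of the line's predicate `PlaquetteLargeFieldRarityG r.ρ δ`;
* `stub_largeFieldRarityG` — the registered stub by name and signature (instance binders `[MeasurableSpace G] [BorelSpace G]`).
G-port of `WeakCouplingRatesLargeFieldTailAllSides` / `stub_largeFieldRarity` (SU(2), p445862).

WHAT THIS IS NOT.  Not a statement about the mass gap; a large-field RARITY bound, uniform in the volume.  The Yang–Mills mass gap is
NOT proved by any of this.

References: [FrohlichIsraelLiebSimon1978] Thm. 4.1; E. Seiler, LNP 159 (1982) Ch. 4.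
-/

set_option autoImplicit false

noncomputable section

open MeasureTheory Filter Topology
open Literature.MathematicalPhysics
open Literature.MathematicalPhysics.QuantumFieldTheory
open Literature.MathematicalPhysics.QuantumLattice
open Literature.Probability.LatticeModels (Torus.proj)
open Summit.QuantumFields.YangMills.Theorems.WeakCouplingRates

namespace Summit.QuantumFields.YangMills.Theorems.ColdBoxAllGroups

variable {G : Type} [Group G] [TopologicalSpace G] [IsTopologicalGroup G] [CompactSpace G] [MeasurableSpace G] [BorelSpace G]

/-- **L2-G of the `dlr-chessboard-G` line, ALL torus sides**: for `0 < δ` there is `β₀` such that for all `β ≥ β₀`, ALL `L ≥ 1`, all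
sites `x` and planes `i ≠ j`, the crude large-field event `{β^{2δ−1} ≤ plaqCostAt r.ρ x i j}` of the plaquette `(x; i, j)` has
`wilsonExpectation_{(L+1)⁴} ≤ exp(−β^δ)` (observable read through the periodic lift). [cite: FrohlichIsraelLiebSimon1978, Thm. 4.1] -/
theorem plaquetteLargeFieldRarityG_allSides (r : LatticeRep G) {δ : ℝ} (hδ : 0 < δ) :
    ∃ β₀ : ℝ, ∀ β : ℝ, β₀ ≤ β → ∀ L : ℕ, 1 ≤ L →
      ∀ (x : Literature.Probability.LatticeModels.Site 4) (i j : Fin 4), i ≠ j →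
        wilsonExpectation (L := L + 1) r.ρ β
            (toTorusObservable (L + 1) fun U : LGConfig 4 G =>
              if β ^ (2 * δ - 1) ≤ plaqCostAt r.ρ x i j U then (1 : ℝ) else 0) ≤
          Real.exp (-(β ^ δ)) := by
  haveI : SecondCountableTopology G := r.secondCountableTopology
  obtain ⟨C, hC, κ, hmain⟩ := measureReal_plaqCost_ge_le_allSidesG r
  obtain ⟨β₀, hβ₀1, hasy⟩ := poly_exp_tail_le_pow hδ hC κ
  refine ⟨β₀, fun β hβ L hL x i j hij => ?_⟩
  have hβ1 : 1 ≤ β := hβ₀1.trans hβ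
  have hβ0 : 0 < β := by linarith
  set ρ := r.ρ with hρdef
  have hρc : Continuous ρ := r.continuous
  -- the event, on the torus
  set S : Set (GaugeConfig 4 (L + 1) G) :=
    {U | β ^ (2 * δ - 1) ≤ (r.N : ℝ) - (ρ (plaquetteHolonomy U (Torus.proj (L + 1) x) i j)).trace.re} with hS
  have hcont : Continuous fun g : G => (ρ g).trace.re := Complex.continuous_re.comp hρc.matrix_trace
  have hmeas : Measurable fun U : GaugeConfig 4 (L + 1) G =>
      (r.N : ℝ) - (ρ (plaquetteHolonomy U (Torus.proj (L + 1) x) i j)).trace.re :=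
    (hcont.measurable.comp (measurable_plaquetteHolonomy _ _ _)).const_sub _
  have hSm : MeasurableSet S := measurableSet_le measurable_const hmeas
  have hind : (toTorusObservable (L + 1) fun U : LGConfig 4 G =>
        if β ^ (2 * δ - 1) ≤ plaqCostAt ρ x i j U then (1 : ℝ) else 0) = S.indicator 1 := by
    funext U
    simp only [toTorusObservable_apply, hS, Set.indicator_apply, Set.mem_setOf_eq, plaqCostAt, QuantumLattice.plaquetteObs,
      FreeEnergy.plaquetteHolonomyZd_torusLift, Pi.one_apply]
  have hexp : wilsonExpectation (L := L + 1) ρ β (toTorusObservable (L + 1) fun U : LGConfig 4 G =>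
        if β ^ (2 * δ - 1) ≤ plaqCostAt ρ x i j U then (1 : ℝ) else 0) = (wilsonMeasure (d := 4) (L := L + 1) ρ β).real S := by
    rw [hind]
    exact integral_indicator_one hSm
  rw [hexp]
  have hs : (0 : ℝ) ≤ β ^ (2 * δ - 1) := Real.rpow_nonneg hβ0.le _
  exact (hmain (L := L + 1) (by omega) β hβ1 _ hs (Torus.proj (L + 1) x) hij).trans (hasy β hβ)

/-- **L2-G, `∀ᶠ L` form** — literally the body of the line's predicate `PlaquetteLargeFieldRarityG r.ρ δ`: for `0 < δ`,
`∃ β₀, ∀ β ≥ β₀, ∀ᶠ L, ∀ x, ∀ i < j`, `wilsonExpectation_{(L+1)⁴} 𝟙{β^{2δ−1} ≤ plaqCostAt r.ρ x i j} ≤ exp(−β^δ)`.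
[cite: FrohlichIsraelLiebSimon1978, Thm. 4.1] -/
theorem plaquetteLargeFieldRarityG_of_latticeRep (r : LatticeRep G) {δ : ℝ} (hδ : 0 < δ) :
    PlaquetteLargeFieldRarityG r.ρ δ := by
  obtain ⟨β₀, h⟩ := plaquetteLargeFieldRarityG_allSides r hδ
  refine ⟨β₀, fun β hβ => ?_⟩
  filter_upwards [eventually_ge_atTop 1] with L hL x i j hij
  exact h β hβ L hL x i j hij.ne

/-- **Registered stub `stub_largeFieldRarityG` of crux `stmt-QuantumFields-22255` (BULK, all `G`)** — L2-G of the `dlr-chessboard-G` line,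
by name and signature (any Borel structure on `G`): for every compact `G`, every faithful continuous unitary `r` and every `δ > 0`,
`PlaquetteLargeFieldRarityG r.ρ δ`. [cite: FrohlichIsraelLiebSimon1978, Thm. 4.1] -/
theorem stub_largeFieldRarityG :
    ∀ (G : Type) [Group G] [TopologicalSpace G] [IsTopologicalGroup G] [CompactSpace G] [MeasurableSpace G] [BorelSpace G]
      (r : LatticeRep G) (δ : ℝ), 0 < δ → PlaquetteLargeFieldRarityG r.ρ δ :=
  fun _ _ _ _ _ _ _ r _ hδ => plaquetteLargeFieldRarityG_of_latticeRep r hδ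

end Summit.QuantumFields.YangMills.Theorems.ColdBoxAllGroups

end
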